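import Literature.MathematicalPhysics.StatisticalMechanics.BarlowLayerPinning
import Summits.Ventures.Crystal3D.Theorems.StickyWulffConstantTextureLiminfTexShadowWallDefs
import HarnessLib

/-!
# EDGE-ON corner, plan of record (cf-p1 (clii)), helper H1: THREE contacts with a complete close-packed layer pin a ball to a HOLLOW site
# (`hollow_of_three_contacts`; lane T crux `TextureLiminfV5`, stmt-Ventures-23912, registered stub `stub_edgeOnSteep`; 19480-p2 g12)

HONEST FRAMING. Venture `Summits/Ventures/Crystal3D` (cell `crystal3d-full`), route `route-Ventures-StickyWulffConstant`, helper `--supports` the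
law-v5 crux `TextureLiminfV5` (stmt-Ventures-23912).  Census-free kissing rigidity, standard axioms; a wrapper of the Literature file
`Literature/Geometry/DiscreteGeometry/LayerPinning` (+ its Barlow-frame corollaries `…/BarlowLayerPinning`); nothing about any wall law; F-C1 not moved.

THE POINT (H1 of the corner plan, «first-layer kissing rigidity»: a filling ball with ≥ 3 contacts to a complete plate layer is CONTINUABLE — it sits
at one of Hales's «two choices for the next layer»).  Let layer `k` of the model stacking `barlowPos 1 √(2/3) σ` carry a ball at EVERY site within
planar distance `1/√3` of the foot of a ball `q` lying strictly above the layer (the local hard core a finite packing supplies), and let `q` touch at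
least THREE balls of that layer.  Then `q` is at height EXACTLY `(k+1)√(2/3)` and over a HOLLOW: its foot is a site of letter `L+1` or `L+2`,
`L = haggLabel σ k` — i.e. `q` is a site of layer `k+1` of SOME Barlow stacking with the same layers `≤ k` (the plate's own continuation, letter
`L + σ k`, or the other hollow class).  Ingredients: `two_thirds_le_sq_height_local` (height² ≥ 2/3), `card_layer_contacts_le_two` (above that
height at most TWO contacts), `barlow_hollow_of_minimal_height_local` (at that height: a hollow).
* **`hollow_of_three_contacts`** — model frame, local hard core, `S ⊆ ℤ²` a set of ≥ 3 contact sites;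
* `card_contacts_le_two_of_not_minimal` — the contrapositive count: strictly above the minimal height, ≤ 2 contacts;
* **`hollow_of_three_contacts_framed`** — the same for a plate presented by a frame `L` and offset `s` (sites `L (barlowPos …) + s`), stated on
  `L⁻¹(y − s)`;
* `mem_stacking_of_hollow_letter` — when the hollow letter is the plate's own next letter (`e ≡ σ k`), the ball is a site of layer `k+1` of the
  plate's stacking itself.
WHAT THIS IS NOT: nothing about which hollows are occupied, no two-plate (coincidence) statement (that is H2), no wall inequality; the «twin»
reading of the second hollow class is exact for locally-fcc layers (`σ (k−1) = σ k`) only — for a locally-hcp layer the second class is a third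
Barlow continuation, which is all H2 needs; F-C1 not moved.
-/

noncomputable section

namespace Summit.Ventures.Crystal3D.Theorems

open Literature.MathematicalPhysics.StatisticalMechanics
open Literature.Geometry.DiscreteGeometry (two_thirds_le_sq_height_local card_layer_contacts_le_two)
open scoped InnerProductSpace

/-! ## Model frame -/

/-- Coordinates of the sites of layer `k` in the `LayerPinning` normal form `(c₀ + i + j/2, c₁ + j·√3/2, h)` with `c₀ = L/2`, `c₁ = (√3/2)(L/3)`,
`h = k√(2/3)`, `L = haggLabel σ k`. -/
theorem barlowPos_layer_coords (σ : ℤ → ℤ) (k i j : ℤ) :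
    barlowPos 1 (Real.sqrt (2 / 3)) σ k i j 0 = (haggLabel σ k : ℝ) / 2 + i + j / 2 ∧
      barlowPos 1 (Real.sqrt (2 / 3)) σ k i j 1 = Real.sqrt 3 / 2 * ((haggLabel σ k : ℝ) / 3) + j * (Real.sqrt 3 / 2) ∧
      barlowPos 1 (Real.sqrt (2 / 3)) σ k i j 2 = (k : ℝ) * Real.sqrt (2 / 3) := by
  refine ⟨?_, ?_, ?_⟩
  · rw [barlowPos_apply_zero]; ring
  · rw [barlowPos_apply_one]; ring
  · rw [barlowPos_apply_two]

/-- **Strictly above the minimal height a ball touches at most two balls of a layer** (model frame): if `(q₂ − k√(2/3))² > 2/3` then at most two sites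
of layer `k` are at distance exactly `1` from `q`. -/
theorem card_contacts_le_two_of_not_minimal (σ : ℤ → ℤ) (k : ℤ) (q : EuclideanSpace ℝ (Fin 3))
    (ht : 2 / 3 < (q 2 - (k : ℝ) * Real.sqrt (2 / 3)) ^ 2) (S : Finset (ℤ × ℤ))
    (hS : ∀ ij ∈ S, ‖q - barlowPos 1 (Real.sqrt (2 / 3)) σ k ij.1 ij.2‖ = 1) : S.card ≤ 2 := by
  refine card_layer_contacts_le_two q ((haggLabel σ k : ℝ) / 2) (Real.sqrt 3 / 2 * ((haggLabel σ k : ℝ) / 3))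
    ((k : ℝ) * Real.sqrt (2 / 3)) ht S fun ij hij => ?_
  obtain ⟨h0, h1, h2⟩ := barlowPos_layer_coords σ k ij.1 ij.2
  exact ⟨_, by rw [h0]; try ring, by rw [h1], h2, hS ij hij⟩

/-- **H1 — THREE CONTACTS PIN A BALL TO A HOLLOW** (model frame, local hard core).  Layer `k` of `barlowPos 1 √(2/3) σ`; a ball `q` strictly above
it (`q₂ > k√(2/3)`), at distance `≥ 1` from every site of the layer within planar squared distance `1/3` of its foot, and at distance EXACTLY `1`
from the sites of a set `S` of at least three sites.  Then `q₂ = (k+1)√(2/3)` and the foot of `q` is a hollow: letter `L + 1` or `L + 2`,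
`L = haggLabel σ k` (Hales's two choices for the next layer). -/
theorem hollow_of_three_contacts (σ : ℤ → ℤ) (k : ℤ) (q : EuclideanSpace ℝ (Fin 3))
    (habove : (k : ℝ) * Real.sqrt (2 / 3) < q 2)
    (hcore : ∀ i j : ℤ, (q 0 - barlowPos 1 (Real.sqrt (2 / 3)) σ k i j 0) ^ 2 +
        (q 1 - barlowPos 1 (Real.sqrt (2 / 3)) σ k i j 1) ^ 2 ≤ 1 / 3 →
      1 ≤ ‖q - barlowPos 1 (Real.sqrt (2 / 3)) σ k i j‖)
    (S : Finset (ℤ × ℤ)) (hS3 : 3 ≤ S.card)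
    (hS : ∀ ij ∈ S, ‖q - barlowPos 1 (Real.sqrt (2 / 3)) σ k ij.1 ij.2‖ = 1) :
    q 2 = ((k : ℝ) + 1) * Real.sqrt (2 / 3) ∧
      ∃ e i j : ℤ, (e = 1 ∨ e = 2) ∧ q 0 = i + j / 2 + ((haggLabel σ k : ℝ) + e) / 2 ∧
        q 1 = Real.sqrt 3 / 2 * (j + ((haggLabel σ k : ℝ) + e) / 3) := by
  set c₀ : ℝ := (haggLabel σ k : ℝ) / 2 with hc₀
  set c₁ : ℝ := Real.sqrt 3 / 2 * ((haggLabel σ k : ℝ) / 3) with hc₁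
  set hk : ℝ := (k : ℝ) * Real.sqrt (2 / 3) with hhk
  -- the layer in `LayerPinning` normal form, with the local hard core
  have hlayer : ∀ a b : ℤ, (q 0 - c₀ - (a + b / 2)) ^ 2 + (q 1 - c₁ - b * (Real.sqrt 3 / 2)) ^ 2 ≤ 1 / 3 →
      ∃ p : EuclideanSpace ℝ (Fin 3), p 0 = c₀ + a + b / 2 ∧ p 1 = c₁ + b * (Real.sqrt 3 / 2) ∧ p 2 = hk ∧ 1 ≤ ‖q - p‖ := by
    intro a b hab
    obtain ⟨h0, h1, h2⟩ := barlowPos_layer_coords σ k a b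
    refine ⟨barlowPos 1 (Real.sqrt (2 / 3)) σ k a b, by rw [h0, hc₀]; try ring, by rw [h1], h2, hcore a b ?_⟩
    rw [h0, h1]
    have e : (q 0 - ((haggLabel σ k : ℝ) / 2 + a + b / 2)) ^ 2 + (q 1 - (Real.sqrt 3 / 2 * ((haggLabel σ k : ℝ) / 3) + b * (Real.sqrt 3 / 2))) ^ 2
        = (q 0 - c₀ - (a + b / 2)) ^ 2 + (q 1 - c₁ - b * (Real.sqrt 3 / 2)) ^ 2 := by rw [hc₀, hc₁]; ring
    rw [e]; exact hab
  -- height² ≥ 2/3; strictly more is impossible with three contacts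
  have h23 : 2 / 3 ≤ (q 2 - hk) ^ 2 := two_thirds_le_sq_height_local q c₀ c₁ hk hlayer
  have heq : (q 2 - hk) ^ 2 = 2 / 3 := by
    rcases h23.eq_or_lt with h | h
    · exact h.symm
    · exfalso
      have := card_contacts_le_two_of_not_minimal σ k q h S hS
      omega
  -- so the height is exactly the minimal one
  have hpos : 0 < q 2 - hk := by rw [hhk]; linarith
  have hz : q 2 = ((k : ℝ) + 1) * Real.sqrt (2 / 3) := by
    have hs : q 2 - hk = Real.sqrt (2 / 3) := by
      have h1 : Real.sqrt ((q 2 - hk) ^ 2) = Real.sqrt (2 / 3) := by rw [heq]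
      rwa [Real.sqrt_sq hpos.le] at h1
    rw [hhk] at hs; linarith
  refine ⟨hz, ?_⟩
  exact barlow_hollow_of_minimal_height_local σ k q hz hcore

/-! ## Framed plates -/

/-- Distances to the sites of a plate presented by the frame `L` and offset `s` are model distances of `L⁻¹(y − s)`. -/
theorem norm_sub_framed_site (L : EuclideanSpace ℝ (Fin 3) ≃ₗᵢ[ℝ] EuclideanSpace ℝ (Fin 3)) (s y p : EuclideanSpace ℝ (Fin 3)) :
    ‖y - (L p + s)‖ = ‖L.symm (y - s) - p‖ := by
  have h : y - (L p + s) = L (L.symm (y - s) - p) := by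
    rw [map_sub, LinearIsometryEquiv.apply_symm_apply]; abel
  rw [h, LinearIsometryEquiv.norm_map]

/-- **H1, framed.**  A plate presented by `(L, s, σ)` (sites `L (barlowPos 1 √(2/3) σ k i j) + s`), a ball `y` strictly above its layer `k` in the
plate's own heights, the local hard core against that layer, and at least three contacts with it: `L⁻¹(y − s)` is at height `(k+1)√(2/3)` over a
hollow of letter `L+1` or `L+2`. -/
theorem hollow_of_three_contacts_framed (L : EuclideanSpace ℝ (Fin 3) ≃ₗᵢ[ℝ] EuclideanSpace ℝ (Fin 3)) (s : EuclideanSpace ℝ (Fin 3))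
    (σ : ℤ → ℤ) (k : ℤ) (y : EuclideanSpace ℝ (Fin 3))
    (habove : (k : ℝ) * Real.sqrt (2 / 3) < (L.symm (y - s)) 2)
    (hcore : ∀ i j : ℤ, ((L.symm (y - s)) 0 - barlowPos 1 (Real.sqrt (2 / 3)) σ k i j 0) ^ 2 +
        ((L.symm (y - s)) 1 - barlowPos 1 (Real.sqrt (2 / 3)) σ k i j 1) ^ 2 ≤ 1 / 3 →
      1 ≤ ‖y - (L (barlowPos 1 (Real.sqrt (2 / 3)) σ k i j) + s)‖)
    (S : Finset (ℤ × ℤ)) (hS3 : 3 ≤ S.card)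
    (hS : ∀ ij ∈ S, ‖y - (L (barlowPos 1 (Real.sqrt (2 / 3)) σ k ij.1 ij.2) + s)‖ = 1) :
    (L.symm (y - s)) 2 = ((k : ℝ) + 1) * Real.sqrt (2 / 3) ∧
      ∃ e i j : ℤ, (e = 1 ∨ e = 2) ∧ (L.symm (y - s)) 0 = i + j / 2 + ((haggLabel σ k : ℝ) + e) / 2 ∧
        (L.symm (y - s)) 1 = Real.sqrt 3 / 2 * (j + ((haggLabel σ k : ℝ) + e) / 3) :=
  hollow_of_three_contacts σ k (L.symm (y - s)) habove
    (fun i j hij => by rw [← norm_sub_framed_site]; exact hcore i j hij) S hS3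
    (fun ij hij => by rw [← norm_sub_framed_site]; exact hS ij hij)

/-! ## The plate's own next letter: the ball is on the plate's stacking -/

/-- **When the hollow letter is the plate's own next letter, the ball is a site of layer `k+1` of the plate's stacking**: letter `L + 1` with
`σ k = 1`, or letter `L + 2` (`≡ L − 1`) with `σ k = −1`. -/
theorem mem_stacking_of_hollow_letter (σ : ℤ → ℤ) (k : ℤ) (q : EuclideanSpace ℝ (Fin 3)) {e i j : ℤ}
    (hz : q 2 = ((k : ℝ) + 1) * Real.sqrt (2 / 3))
    (hx : q 0 = i + j / 2 + ((haggLabel σ k : ℝ) + e) / 2) (hy : q 1 = Real.sqrt 3 / 2 * (j + ((haggLabel σ k : ℝ) + e) / 3))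
    (he : (e = 1 ∧ σ k = 1) ∨ (e = 2 ∧ σ k = -1)) :
    q ∈ barlowStacking 1 (Real.sqrt (2 / 3)) σ := by
  have hlab : (haggLabel σ (k + 1) : ℝ) = haggLabel σ k + σ k := by rw [haggLabel_succ]; push_cast; ring
  rcases he with ⟨rfl, hk⟩ | ⟨rfl, hk⟩
  · -- letter `L + 1`: the site `(k+1, i, j)` itself
    have hlab' : (haggLabel σ (k + 1) : ℝ) = haggLabel σ k + 1 := by rw [hlab, hk]; push_cast; ring
    refine ⟨k + 1, i, j, ?_⟩
    ext t
    fin_cases t <;> simp [hx, hy, hz, barlowPos_apply_zero, barlowPos_apply_one, barlowPos_apply_two, hlab']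
  · -- letter `L + 2 ≡ L − 1`: the site `(k+1, i+1, j+1)` (shift by `3·offset = a₁ + a₂`)
    have hlab' : (haggLabel σ (k + 1) : ℝ) = haggLabel σ k - 1 := by rw [hlab, hk]; push_cast; ring
    refine ⟨k + 1, i + 1, j + 1, ?_⟩
    ext t
    fin_cases t <;> simp [hx, hy, hz, barlowPos_apply_zero, barlowPos_apply_one, barlowPos_apply_two, hlab'] <;> ring

end Summit.Ventures.Crystal3D.Theorems

end
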